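import Mathlib
import Summits.PneNP.PneNP.Theses.OverlapGapAlgebra
import Summits.PneNP.PneNP.Theorems.OverlapGapAlgebraNoStableSection
import Summits.PneNP.PneNP.Theorems.OverlapGapAlgebraSearchHardWindowSmoothMapsFail
import Summits.PneNP.PneNP.Theorems.OverlapGapAlgebraSearchHardWindowWeakLowDegree
import Summits.PneNP.PneNP.Theorems.OverlapGapAlgebraSearchHardWindowConstLowDegree
import Literature.Computability.Complexity.RandomKSatLowDegreeHardness

/-!
# Route OverlapGapAlgebra, crux `SearchHardWindow` (stmt-PneNP-2460): the smooth-maps and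
# low-degree rungs, UNCONDITIONAL

The route's probability crux `NoStableSection` (stmt-PneNP-2462; Bresler–Huang's ensemble multi-OGP
read for arbitrary maps) is now a tree theorem (`noStableSection_proof`,
`…OverlapGapAlgebraNoStableSection.lean`). The three rungs of this seat that were conditional on it
only are therefore theorems with no hypothesis and no named fact:

* `smoothMapsFail` — Bresler–Huang 2021 Thm. 2.6 in its general "smooth maps" counting form: in the
  window `α_k = 5·2^k log k/k`, `k ≥ k₀`, every map `g` whose `ηn`-jumps under single-literal
  replacement are at most a `c·n/((mk) log 2n)`-fraction of all (instance, slot, literal) triples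
  violates `> νm` clauses on `> (c n/log 2n)/(km) · #Inst` instances;
* `weakLowDegreeHardness` — deterministic saturated low-degree form (degree `o(n/log n)`, energy
  `O(n)`): success `≤ 1 − c/log(2n)`;
* `constLowDegreeHardness` — degree `o(n/log² n)`: success `≤ 1 − δ_k`, a constant failure
  probability (via the union-bound-free scan correlation inequality `scc_count`).

No definitions; axioms standard.

References: G. Bresler, B. Huang, FOCS 2021 / arXiv:2106.02129, Thm. 2.6 [BreslerHuang2022];
B. Huang, M. Sellke, arXiv:2501.06427, Cor. 3.21 [HuangSellke2025].
-/

namespace Summit.PneNP.PneNP.Theorems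

set_option linter.dupNamespace false -- `Summit.PneNP.PneNP.…`: summit = sub-problem (D-0017)

open Finset Filter Asymptotics
open Summit.PneNP.PneNP.Theses.OverlapGapAlgebra
open Literature.Computability.Complexity (IsCoordDegreeLE)

/-- **Smooth maps fail at the window density (Bresler–Huang 2021 Thm. 2.6, general counting form),
unconditionally.** For `k ≥ k₀` there are `η, ν, c > 0` such that for all large `n`,
`m = ⌊5·2^k log k/k · n⌋₊`, every map `g : instances → assignments` with at most
`(c n/log 2n)·#Inst·2n` triples `(Φ, (a,b), ℓ)` on which replacing the literal of `Φ` in slot `(a,b)`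
by `ℓ` moves `g` by more than `ηn` in Hamming distance violates more than `νm` clauses on more than
`(c n/log 2n)/(km)·#Inst` instances. [BreslerHuang2022, Thm. 2.6] -/
theorem smoothMapsFail :
    ∃ k₀ : ℕ, ∀ k : ℕ, k₀ ≤ k → ∃ η : ℝ, 0 < η ∧ ∃ ν : ℝ, 0 < ν ∧ ∃ c : ℝ, 0 < c ∧
      ∀ᶠ n : ℕ in Filter.atTop, ∀ m : ℕ, m = ⌊5 * 2 ^ k * Real.log k / k * n⌋₊ →
        ∀ g : (Fin m → Fin k → Fin n × Bool) → (Fin n → Bool),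
          (∑ a : Fin m, ∑ b : Fin k,
              (((Finset.univ : Finset ((Fin m → Fin k → Fin n × Bool) × (Fin n × Bool))).filter
                fun p => η * n < hammingDist (g p.1)
                  (g (Function.update p.1 a (Function.update (p.1 a) b p.2)))).card : ℝ))
            ≤ c * n / Real.log (2 * n) * (Fintype.card (Fin m → Fin k → Fin n × Bool) * (2 * n)) →
          c * n / Real.log (2 * n) * Fintype.card (Fin m → Fin k → Fin n × Bool) <
            (k * m : ℕ) * ((Finset.univ.filter fun Φ : Fin m → Fin k → Fin n × Bool =>
              ν * m < ((Finset.univ.filter fun i : Fin m =>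
                ∀ j, g Φ (Φ i j).1 ≠ (Φ i j).2).card : ℝ)).card : ℝ) :=
  smoothMapsFail_of_noStableSection noStableSection_proof

/-- **Weak low-degree hardness of random `k`-SAT at the window density (Bresler–Huang 2021
Thm. 2.6, deterministic saturated form), unconditionally.** For `k ≥ k₀` there is `c > 0` such that
for every energy constant `C`, every degree sequence `D_n = o(n/log n)` and every sequence of
vector-valued maps of coordinate degree `≤ D_n` and energy `≤ C n · #Inst` on the literal arrays of
`F_k(n, ⌊5·2^k log k/k · n⌋)`, eventually the arrays on which every output coordinate has modulus
`≥ 1` and the sign assignment satisfies the instance number at most `(1 − c/log 2n)·#Inst`.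
[BreslerHuang2022, Thm. 2.6] -/
theorem weakLowDegreeHardness :
    ∃ k₀ : ℕ, ∀ k : ℕ, k₀ ≤ k → ∃ c : ℝ, 0 < c ∧ ∀ C : ℝ, 0 < C → ∀ D : ℕ → ℕ,
      (fun n : ℕ => (D n : ℝ)) =o[atTop] (fun n : ℕ => (n : ℝ) / Real.log n) →
      ∀ F : (n : ℕ) → (m : ℕ) → (Fin m → Fin k → Fin n × Bool) → Fin n → ℝ,
        (∀ (n m : ℕ) (v : Fin n), IsCoordDegreeLE (D n)
            (fun y : Fin m × Fin k → Fin n × Bool => F n m (Function.curry y) v)) →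
        (∀ n m : ℕ, m = ⌊5 * 2 ^ k * Real.log k / k * n⌋₊ →
            ∑ Φ : Fin m → Fin k → Fin n × Bool, ∑ v : Fin n, F n m Φ v ^ 2
              ≤ C * n * Fintype.card (Fin m → Fin k → Fin n × Bool)) →
        ∀ᶠ n : ℕ in atTop, ∀ m : ℕ, m = ⌊5 * 2 ^ k * Real.log k / k * n⌋₊ →
          ((univ.filter fun Φ : Fin m → Fin k → Fin n × Bool =>
              (∀ v : Fin n, 1 ≤ |F n m Φ v|) ∧
              ∀ i : Fin m, ∃ j : Fin k, decide (0 ≤ F n m Φ (Φ i j).1) = (Φ i j).2).card : ℝ)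
            ≤ (1 - c / Real.log (2 * n)) * Fintype.card (Fin m → Fin k → Fin n × Bool) :=
  weakLowDegreeHardness_of_noStableSection noStableSection_proof

/-- **Low-degree hardness of random `k`-SAT at the window density with a CONSTANT failure
probability, unconditionally.** For `k ≥ k₀` there is `δ > 0` (depending on `k` only) such that for
every energy constant `C`, every degree sequence `D_n = o(n/log² n)` and every sequence of
vector-valued maps of coordinate degree `≤ D_n` and energy `≤ C n · #Inst` on the literal arrays of
`F_k(n, ⌊5·2^k log k/k · n⌋)`, eventually the arrays on which every output coordinate has modulus
`≥ 1` and the sign assignment satisfies the instance number at most `(1 − δ)·#Inst`.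
[BreslerHuang2022, Thm. 2.6; HuangSellke2025, Cor. 3.21] -/
theorem constLowDegreeHardness :
    ∃ k₀ : ℕ, ∀ k : ℕ, k₀ ≤ k → ∃ δ : ℝ, 0 < δ ∧ ∀ C : ℝ, 0 < C → ∀ D : ℕ → ℕ,
      (fun n : ℕ => (D n : ℝ)) =o[atTop] (fun n : ℕ => (n : ℝ) / Real.log n ^ 2) →
      ∀ F : (n : ℕ) → (m : ℕ) → (Fin m → Fin k → Fin n × Bool) → Fin n → ℝ,
        (∀ (n m : ℕ) (v : Fin n), IsCoordDegreeLE (D n)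
            (fun y : Fin m × Fin k → Fin n × Bool => F n m (Function.curry y) v)) →
        (∀ n m : ℕ, m = ⌊5 * 2 ^ k * Real.log k / k * n⌋₊ →
            ∑ Φ : Fin m → Fin k → Fin n × Bool, ∑ v : Fin n, F n m Φ v ^ 2
              ≤ C * n * Fintype.card (Fin m → Fin k → Fin n × Bool)) →
        ∀ᶠ n : ℕ in atTop, ∀ m : ℕ, m = ⌊5 * 2 ^ k * Real.log k / k * n⌋₊ →
          ((univ.filter fun Φ : Fin m → Fin k → Fin n × Bool =>
              (∀ v : Fin n, 1 ≤ |F n m Φ v|) ∧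
              ∀ i : Fin m, ∃ j : Fin k, decide (0 ≤ F n m Φ (Φ i j).1) = (Φ i j).2).card : ℝ)
            ≤ (1 - δ) * Fintype.card (Fin m → Fin k → Fin n × Bool) :=
  constLowDegreeHardness_of_noStableSection noStableSection_proof

end Summit.PneNP.PneNP.Theorems
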